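import Mathlib
import Summits.Ventures.PercRepro2.Harris
import Summits.Ventures.PercRepro2.BasePrime
import Summits.Ventures.PercRepro2.LocRows
import Summits.Ventures.PercRepro2.SwRow
import Summits.Ventures.PercRepro2.SwOut
import Summits.Ventures.PercRepro2.SwAllRow
import Summits.Ventures.PercRepro2.SwOutAll
import Summits.Ventures.PercRepro2.SwOutCube
import Summits.Ventures.PercRepro2.SwOutArmFlip
import Summits.Ventures.PercRepro2.SwOutArms
import Summits.Ventures.PercRepro2.SwOutArmOrbit
import Summits.Ventures.PercRepro2.SwOutArmCube
import Summits.Ventures.PercRepro2.SwOutArmThm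
import Summits.Ventures.PercRepro2.SwOutCoreDefs
import Summits.Ventures.PercRepro2.SwOutCoreHull
import Summits.Ventures.PercRepro2.SwOutCoreDual
import Summits.Ventures.PercRepro2.SwOutEdgeDefs
import Summits.Ventures.PercRepro2.SwOutEdgeHull
import Summits.Ventures.PercRepro2.SwOutEdgeDual

/-!
# THE e-CORE CUBE INEQUALITY (blind cell PercRepro2, night-4 g16, 2026-08-26;
proofs/NIGHT4-G15.md §4 (L1–L3), proofs/NIGHT4-G16.md §1)

On the e-core cube of an e-core base (the junction `u` adjacent to `h`; the h–u edges one more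
cube coordinate) — the realisations `coreRealE ζ ω`, `ω : Config (Option ι)` — the red edge set of
`h` is increasing in the cube point (`redEdges_coreRealE_mono`: a red h–u edge stays red going
up, a red arm edge keeps its colour), the blue edge set decreasing (`blueEdges_coreRealE_anti`),
the flip of the cube exchanges them (`blueEdges_coreRealE_flipAll`), and the conditioning `Q`
pulls back to a lower set (`coreRealE_mem_tgtU_of_le`).  The cube principle in its edge-set form
(`card_le_of_cube_edges`) then gives the rigid counting inequality on the e-core cube
(**`card_coreCubeE_le`**): the core-cube block of Theorem A⁺ (NIGHT4-G15.md §4) in the kernel.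
-/

namespace Summit.Ventures.PercRepro2

namespace LocRows

open Hull

variable {V : Type*} {E : Type*}

open scoped Classical

variable {ends : E → Sym2 V}

section Edges

variable {ι : Type*} {A : ι → Set V} {pure : ι → Prop} {ζ : Config E} {h u : V} {H : Set V}
  (hb : CoreBaseE ends ζ h u H A pure)
include hb

/-- An edge inside `redSetE ω` is an h–u edge or has an end in a red arm. -/
lemma CoreBaseE.exists_red_arm_of_within_redSetE {ω : Config (Option ι)} {e : E}
    (hw : e ∈ within ends (redSetE ends A h u pure ω)) :
    ends e = s(h, u) ∨ ∃ i x y, ends e = s(x, y) ∧ x ∈ A i ∧ ω (some i) = true := by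
  obtain ⟨x, hx, y, hy, hxy⟩ := hw
  -- an end in an arm is in a red arm
  have key : ∀ z ∈ redSetE ends A h u pure ω, ∀ i, z ∈ A i → ω (some i) = true := by
    intro z hz i hzi
    rw [mem_redSetE_iff] at hz
    rcases hz with rfl | ⟨j, hj, _, hzj⟩ | ⟨_, rfl | ⟨j, hj, _, hzj⟩⟩
    · exact absurd hzi (hb.h_notMem_arm i)
    · have : j = i := by
        by_contra hne
        exact hb.arm_disj j i hne z hzj hzi
      exact this ▸ hj
    · exact absurd hzi (hb.u_notMem_arm i)
    · have : j = i := by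
        by_contra hne
        exact hb.arm_disj j i hne z hzj hzi
      exact this ▸ hj
  by_cases hxA : ∃ i, x ∈ A i
  · obtain ⟨i, hxi⟩ := hxA
    exact Or.inr ⟨i, x, y, hxy, hxi, key x hx i hxi⟩
  by_cases hyA : ∃ i, y ∈ A i
  · obtain ⟨i, hyi⟩ := hyA
    exact Or.inr ⟨i, y, x, ends_swap hxy, hyi, key y hy i hyi⟩
  left
  -- neither end is in an arm: both are `h` or `u`
  have hxhu : x = h ∨ x = u := by
    rw [mem_redSetE_iff] at hx
    rcases hx with rfl | ⟨j, _, _, hxj⟩ | ⟨_, rfl | ⟨j, _, _, hxj⟩⟩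
    · exact Or.inl rfl
    · exact absurd ⟨j, hxj⟩ hxA
    · exact Or.inr rfl
    · exact absurd ⟨j, hxj⟩ hxA
  have hyhu : y = h ∨ y = u := by
    rw [mem_redSetE_iff] at hy
    rcases hy with rfl | ⟨j, _, _, hyj⟩ | ⟨_, rfl | ⟨j, _, _, hyj⟩⟩
    · exact Or.inl rfl
    · exact absurd ⟨j, hyj⟩ hyA
    · exact Or.inr rfl
    · exact absurd ⟨j, hyj⟩ hyA
  rcases hxhu with rfl | rfl <;> rcases hyhu with rfl | rfl
  · exact absurd hxy (hb.loop_h e)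
  · exact hxy
  · exact ends_swap hxy
  · exact absurd hxy (hb.loop_u e)

/-- **The red edge set of `h` grows with the cube point.** -/
theorem CoreBaseE.redEdges_coreRealE_mono {ω ω' : Config (Option ι)} (hω : ω ≤ ω') :
    redEdges ends (coreRealE ends A h u ζ ω) h ⊆ redEdges ends (coreRealE ends A h u ζ ω') h := by
  intro e he
  rw [mem_redEdges] at he ⊢
  obtain ⟨hred, hw⟩ := he
  have hle : ∀ j, ω j = true → ω' j = true := by
    intro j hj
    have := hω j
    rw [hj] at this
    cases h' : ω' j
    · rw [h'] at this; exact absurd this (by simp)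
    · rfl
  refine ⟨?_, ?_⟩
  · rw [hb.cluster_coreRealE] at hw
    rcases hb.exists_red_arm_of_within_redSetE hw with hhu | ⟨i, x, y, hxy, hxi, hi⟩
    · -- a red h–u edge: `ω none = true`, so `ω' none = true`
      rw [CoreBaseE.coreRealE_apply_hu (A := A) (ζ := ζ) hhu, hb.hu_red hhu] at hred ⊢
      have hn : ω none = true := by
        by_contra hn
        rw [if_neg hn] at hred
        exact absurd hred (by decide)
      rw [if_pos (hle none hn)]
    · rw [hb.coreRealE_apply_of_mem hxy hxi, if_pos hi] at hred
      rw [hb.coreRealE_apply_of_mem hxy hxi, if_pos (hle _ hi)]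
      exact hred
  · obtain ⟨x, hx, y, hy, hxy⟩ := hw
    exact ⟨x, hb.cluster_coreRealE_mono hω hx, y, hb.cluster_coreRealE_mono hω hy, hxy⟩

/-- **The blue edge set of `h` shrinks with the cube point.** -/
theorem CoreBaseE.blueEdges_coreRealE_anti {ω ω' : Config (Option ι)} (hω : ω ≤ ω') :
    blueEdges ends (coreRealE ends A h u ζ ω') h ⊆ blueEdges ends (coreRealE ends A h u ζ ω) h := by
  unfold blueEdges
  rw [hb.blue_coreRealE, hb.blue_coreRealE]
  exact hb.dual.redEdges_coreRealE_mono (flipAll_le_flipAll hω)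

/-- The red edge sets of `h` of the base and of the dual base agree at every cube point. -/
lemma CoreBaseE.redEdges_coreRealE_dual (ω : Config (Option ι)) :
    redEdges ends (coreRealE ends A h u (dualBaseE ends A h u ζ) ω) h =
      redEdges ends (coreRealE ends A h u ζ ω) h := by
  ext e
  rw [mem_redEdges, mem_redEdges, hb.cluster_coreRealE, hb.dual.cluster_coreRealE]
  -- the colour of an edge inside `redSetE ω` agrees for the base and the dual base
  suffices hcol : e ∈ within ends (redSetE ends A h u pure ω) →
      coreRealE ends A h u (dualBaseE ends A h u ζ) ω e = coreRealE ends A h u ζ ω e by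
    constructor
    · rintro ⟨hred, hw⟩
      exact ⟨by rw [← hcol hw]; exact hred, hw⟩
    · rintro ⟨hred, hw⟩
      exact ⟨by rw [hcol hw]; exact hred, hw⟩
  intro hw
  rcases hb.exists_red_arm_of_within_redSetE hw with hhu | ⟨i, x, y, hxy, hxi, hi⟩
  · rw [CoreBaseE.coreRealE_apply_hu (A := A) (ζ := dualBaseE ends A h u ζ) hhu,
      CoreBaseE.coreRealE_apply_hu (A := A) (ζ := ζ) hhu, dualBaseE_apply_hu hhu]
  · rw [hb.dual.coreRealE_apply_of_mem hxy hxi, hb.coreRealE_apply_of_mem hxy hxi,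
      dualBaseE_apply_of_mem (CoreBase.touches_allArms_of_mem hxy hxi)
        (hb.not_hu_of_mem hxy hxi)]

/-- **The flip of the cube exchanges the red and the blue edge sets.** -/
theorem CoreBaseE.blueEdges_coreRealE_flipAll (ω : Config (Option ι)) :
    blueEdges ends (coreRealE ends A h u ζ (flipAll ω)) h =
      redEdges ends (coreRealE ends A h u ζ ω) h := by
  unfold blueEdges
  rw [hb.blue_coreRealE, flipAll_involutive ω]
  exact hb.redEdges_coreRealE_dual ω

end Edges

section Cube

variable [Fintype E] [DecidableEq E]
variable {ι : Type*} {A : ι → Set V} {pure : ι → Prop} {ζ : Config E} {h u : V} {H : Set V}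
  (hb : CoreBaseE ends ζ h u H A pure)
include hb

/-- **The conditioning `Q` pulls back to a lower set of the e-core cube** (`l ∉ H`). -/
theorem CoreBaseE.coreRealE_mem_tgtU_of_le {l o : V} (hl : l ∉ H) {ω ω' : Config (Option ι)}
    (hω : ω ≤ ω') (hQ : coreRealE ends A h u ζ ω' ∈ tgtU ends l h {S : Set V | o ∈ S}) :
    coreRealE ends A h u ζ ω ∈ tgtU ends l h {S : Set V | o ∈ S} := by
  simp only [tgtU, Finset.mem_filter, Finset.mem_univ, true_and, Set.mem_setOf_eq, hull,
    Set.mem_union, not_or] at hQ ⊢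
  obtain ⟨⟨_, _⟩, hoA, hoB⟩ := hQ
  refine ⟨⟨?_, ?_⟩, ?_, ?_⟩
  · intro hh
    exact hl (hb.cluster_coreRealE_subset ω (conn_symm hh))
  · intro hh
    exact hl (hb.hull_coreRealE_subset ω (Or.inr (conn_symm hh)))
  · exact hb.cluster_l_coreRealE_anti hl hω hoA
  · exact fun h' => hoB (hb.cluster_blue_l_coreRealE_mono hl hω h')

omit hb in
/-- The e-core cube: the realisations of all cube points. -/
noncomputable def coreCubeE [Fintype ι] (ends : E → Sym2 V) (A : ι → Set V) (h u : V)
    (ζ : Config E) : Finset (Config E) :=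
  Finset.univ.image (coreRealE ends A h u ζ)

omit [DecidableEq E] hb in
/-- Membership in the e-core cube. -/
lemma mem_coreCubeE [Fintype ι] {ζ' : Config E} :
    ζ' ∈ coreCubeE ends A h u ζ ↔ ∃ ω, coreRealE ends A h u ζ ω = ζ' := by
  simp only [coreCubeE, Finset.mem_image, Finset.mem_univ, true_and]

/-- **THE e-CORE CUBE INEQUALITY**: the rigid counting inequality on the e-core cube of an e-core
base (`H ⊆ U`, `l ∉ U`), for every up-set `𝓔` of edge sets. -/
theorem CoreBaseE.card_coreCubeE_le [Fintype ι] {U : Set V} {l o : V} (hHU : H ⊆ U) (hl : l ∉ U)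
    {𝓔 : Set (Set E)} (h𝓔 : IsUpperSet 𝓔) :
    ((coreCubeE ends A h u ζ).filter fun ζ' =>
        ζ' ∈ tgtU ends l h {S : Set V | o ∈ S} ∧ redEdges ends ζ' h ∈ 𝓔).card ≤
      ((coreCubeE ends A h u ζ).filter fun ζ' =>
        ζ' ∈ tgtU ends l h {S : Set V | o ∈ S} ∧ blueEdges ends ζ' h ∈ 𝓔).card := by
  have hlH : l ∉ H := fun h' => hl (hHU h')
  have key := card_le_of_cube_edges (ends := ends) (coreRealE ends A h u ζ)
    hb.coreRealE_injective (coreCubeE ends A h u ζ) (fun ζ' => mem_coreCubeE)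
    (↑(tgtU ends l h {S : Set V | o ∈ S}))
    (fun ω' ω hω hQ => hb.coreRealE_mem_tgtU_of_le hlH hω hQ) h
    (fun 𝓔' h𝓔' ω ω' hω hω𝓔 => h𝓔' (hb.redEdges_coreRealE_mono hω) hω𝓔)
    (fun 𝓔' h𝓔' ω' ω hω hω𝓔 => h𝓔' (hb.blueEdges_coreRealE_anti hω) hω𝓔)
    (fun ω => hb.blueEdges_coreRealE_flipAll ω) h𝓔
  simpa only [Finset.mem_coe] using key

end Cube

end LocRows

end Summit.Ventures.PercRepro2
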